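import Literature.MathematicalPhysics.QuantumFieldTheory.Balaban1983to89.B7Eq211GeneralRec

/-!
# `Balaban1983to89.B7Eq214GeneralRec` — [Balaban1985Averaging] (212)–(214) p. 50: `Q′_j(u₁, λ) = (Q′_jλ) + C′_j(u₁, λ)`, `|C′_j| = O((α₃α₄ + α₄²)Lʲη)`, AT A GENERAL REGULAR BACKGROUND, FOR THE
# RECORD (centred blocks, (0.4) average) — the record twin of the engine's `B7Eq214General` §3, sequel of `B7Eq211GeneralRec`

statement-level skeleton of published theorems with citation tags; proofs where landed; nothing here is a claim about the Yang–Mills mass gap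

CITATION HEADER (lean-in-tree rule).  Cell `pub-ymgap`, seat `pub-ymgap-dag-n05-e` g36 (N05-REC LEAD PEN); item R1 ([3] layer), Sect. G block, file 8.  `--kind proof --supports stmt-QuantumFields-20541` (K0⁷;
count-neutral; no definition).  Sources READ: [3] = [Balaban1985Averaging] p. 50 (207)–(214), p. 49 (203)–(204) (`paper:balaban1985-cmp98-averaging`); [I] = [Balaban1987RG1] (0.3)–(0.4) pp. 252–253.
REUSED BY NAME: `B7Eq211GeneralRec.{eq211Z_general, norm_rlamZ_le, rlamZ_sub}`, `B7ConclGaugeLin.two_le_C6'`, `B7Prop10GeneralRec.{prop10_generalZ, levels_of52Z}`, the engine's `B7Eq214General.Cgen`, `B7Eq214.{ineq176_of_207,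
ineq177_of_207}`, `B7.sum_pow_succ_le`, `B7Prop10General.{C6, C4G, rhs203G_le, rhs204G_le, covBondBd_mono}`, `B7Prop8Flat.pow_eta_le`; the record's `lamAvgGZ ∕ rlamZ ∕ utilGZ ∕ vtilGZ ∕ InLambdaZ ∕ CovBlockBdZ`.

WHAT IS PROVED (sorry-free; `L = 2s + 1`, `s ≥ 1`, `d ≥ 1`).  ★`eq212Z_general` (the level induction: `‖log ũ′ʲ(z) − (Q′_jλ)(z)‖ ≤ 4416(d+1)C₆(α₃α₄ + α₄²)·Σ_{l<j}L^{l+1}η`), ★★`eq214Z_general` ((213)–(214) for the record,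
`C′_gen = 8832(d+1)C₆`), `eq214Z_general_of52`, ★`eq214Z_general_of207` (print's datum (207), constant `16C′_gen`).
HONEST SCOPE.  Port of the engine's estimates to the record's objects (same constants); nothing of [3]∕[I] asserted beyond what is proved; `HThm4Rec` UNDISCHARGED; N05 discharged of record untouched;
N07 not claimable; counts unmoved (typed 28∕28 · discharged 8∕28); one finite 𝕋⁴ programme at fixed ε — nothing continuum ∕ ℝ⁴ ∕ OS ∕ mass gap ∕ Clay.  No `def`, no `instance`, no `notation`, no `sorry`.
-/

set_option autoImplicit false

noncomputable section

open scoped BigOperators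
open NormedSpace Finset

namespace Literature.MathematicalPhysics.QuantumFieldTheory.Balaban1983to89.B7Eq214GeneralRec

open B7Prop1Explicit hiding Site
open B7Prop1Explicit renaming Site → SiteZ
open MatrixLog B7Eq92Concrete
open B7Eq99Concrete (R0fun R0fun_apply R0fun_self R0fun_add)
open B7Prop2Explicit (pdev c2')
open B7Eq170Flat (cj cj_apply val_Rc_eq_cj mlog_cj mlog_exp_of_le)
open B7Prop6Flat (norm_units_inv_sub_one_le)
open B7Prop8Flat (pow_eta_le)
open B7Prop9Flat (SiteBd C5')
open B7Prop9General (CovBondBd)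
open B7Prop10Flat (siteBd_mono one_le_C5)
open B7Prop10General (C6 C4G rhs203G rhs204G rhs203G_le rhs204G_le covBondBd_mono)
open B7Eq214General (Cgen)
open BlockAveragingZd (avgIterZ offZ)
open B7SectCDGaugeAveragesRec (uavgZ)
open B7SectEFLinearisationRec (rlamZ lamAvgGZ lamAvgGZ_zero lamAvgGZ_succ utilGZ utilGZ_zero utilGZ_succ vtilGZ InLambdaZ Cond167Z CovBlockBdZ)
open B7Prop2Rec (AvgClosedZ C0Z)
open B7Prop10GeneralRec (prop10_generalZ levels_of52Z)
open B7Eq211GeneralRec (eq211Z_general norm_rlamZ_le rlamZ_sub)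
open B7ConclGaugeLin (two_le_C6')

variable {d : ℕ}

/-! ## (212)–(214) for the record -/

section Levels

variable {𝔸 : Type*} [NormedRing 𝔸] [NormOneClass 𝔸] [NormedAlgebra ℂ 𝔸] [CompleteSpace 𝔸]
variable {L s : ℕ} {U₀ : SiteZ d → Fin d → 𝔸ˣ} {k : ℕ} {u' u₁ : SiteZ d → 𝔸ˣ} {α₀ α₃ α₄ η : ℝ}

/-- **(212) AT A GENERAL BACKGROUND, kernel form (sum version).**  Print (p. 50): "By (179) the function `Q′_j(u₁, λ)` is a composition
of one-step functions and from the above formula we can easily see that `Q′_j(u₁, λ, y) = Σ_{x∈Bʲ(y)} L^{−jd}R(U₀(Γ^{(j)}_{y,x}))λ(x) +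
Σ_{l=0}^{j−1} O(C₅α₄2α₄Lˡη + α₃2α₄(Lˡη)² + 4α₄²(Lˡη)²)`, (212)" — `Q′_j(u₁, λ) = (1/i) log ũ′ʲ` (208), `λ = (1/i) log u′`.
HERE, under the hypotheses of `B7Prop10General.prop10_general` — the DISPLAYED level hypotheses `Ū₀ʲ ∈ U1` and `‖Ū₀ʲ(∂p) − 1‖ ≤
2α₀(Lʲη)²` (`j < k`; p. 49 "`α₀` replaced by `2α₀(Lʲη)²`"; discharged from (52) in `eq214_general_of52`), (176) `SiteBd u′ α₄`, (177)
`CovBondBd U₀ u′ (α₄η)`, (166)–(167) `u₁ ∈ Λ_k(U₀, α₃)` (`B7Eq167Flat.InLambda`), `L ≥ 2`, `0 ≤ η`, `Lᵏη ≤ 1`, and the explicit smallness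
`0 ≤ α₃ ≤ 1/200`, `0 ≤ α₄`, `50C₆α₄ ≤ 1`, `3·10³(d+1)Lα₄ ≤ 1`, `C₄(α₀ + α₃ + α₄) ≤ 1` (`C₄ = B7Prop10General.C4G d L`), `0 ≤ α₀`,
`1024(d+1)(d+4)L²α₀ ≤ 1`, `32(d+1)²C₆L²α₀ ≤ 1`, `16dC′₅C₆L²α₀ ≤ 1`, `8dC₆Lα₀ ≤ 1` —: for every `j ≤ k` and every `z`,
`‖log ũ′ʲ(z) − (Q′_jλ)(z)‖ ≤ 4416(d+1)C₆(α₃α₄ + α₄²)·Σ_{l<j} L^{l+1}η` (`ũ′ʲ = B7Prop10General.utilGZ L U₀ u′ u₁ j`, `Q′_jλ =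
lamAvgGZ L U₀ j λ`, `λ = log u′`).  PROOF = print's induction over the levels: the step is `eq211_general` at the background `Ū₀ʲ` for
`v′ = ũ′ʲ`, `v₁ = ū₁ʲ` (`utilGZ_succ`) with the level constants of `prop10_general` ((204) `≤ C₆α₄` in the `α₄`-slot, (203) `≤ 2α₄Lʲη` in
the `α′₄`-slot, (167) `α₃L^{j+1}η` in the `β`-slot, `2α₀(Lʲη)²` in the `α₀`-slot; `a′ ≤ 3α₄Lʲη` by `8dC₆Lα₀ ≤ 1`), and the rotated block
mean does not increase the sup norm of the accumulated error (`norm_rlam_le`).  At `U₀ = 1`: `B7Eq214Flat.eq212_flat` up to the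
constants. [cite: Balaban1985Averaging, (212) p.50, (179) p.45, (203)–(204) p.49] -/
theorem eq212Z_general (hLs : L = 2 * s + 1) (hs1 : 1 ≤ s) (hd : 1 ≤ d)
    (hV : ∀ j < k, ∀ (x : SiteZ d) (κ : Fin d), avgIterZ L U₀ j x κ ∈ U1 𝔸)
    (h52 : ∀ j < k, ∀ (x : SiteZ d) (κ μ : Fin d), κ ≠ μ →
      ‖((hol (avgIterZ L U₀ j) x (plaqWord κ μ) : 𝔸ˣ) : 𝔸) - 1‖ ≤ 2 * α₀ * ((L : ℝ) ^ j * η) ^ 2)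
    (h176 : SiteBd u' α₄) (h177 : CovBondBd U₀ u' (α₄ * η)) (hu₁ : InLambdaZ L U₀ u₁ k α₃ η)
    (hη : 0 ≤ η) (hk : (L : ℝ) ^ k * η ≤ 1) (hα₀ : 0 ≤ α₀) (hα₃ : 0 ≤ α₃) (hα₃' : α₃ ≤ 1 / 200) (hα₄ : 0 ≤ α₄)
    (hs₁ : 50 * C6 d * α₄ ≤ 1) (hs₂ : 3000 * ((d : ℝ) + 1) * L * α₄ ≤ 1) (hs₃ : C4G d L * (α₀ + α₃ + α₄) ≤ 1)
    (hs₄ : 1024 * ((d : ℝ) + 1) * ((d : ℝ) + 4) * L ^ 2 * α₀ ≤ 1) (hs₅ : 32 * ((d : ℝ) + 1) ^ 2 * C6 d * L ^ 2 * α₀ ≤ 1)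
    (hs₆ : 16 * d * C5' d * C6 d * (L : ℝ) ^ 2 * α₀ ≤ 1) (hs₇ : 8 * d * C6 d * L * α₀ ≤ 1) :
    ∀ j ≤ k, ∀ z : SiteZ d,
      ‖mlog ((utilGZ L U₀ u' u₁ j z : 𝔸ˣ) : 𝔸) - lamAvgGZ L U₀ j (fun x => mlog ((u' x : 𝔸ˣ) : 𝔸)) z‖
        ≤ 4416 * ((d : ℝ) + 1) * C6 d * (α₃ * α₄ + α₄ ^ 2) * ∑ i ∈ range j, (L : ℝ) ^ (i + 1) * η := by
  have hL : 2 ≤ L := by omega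
  have hL1 : 1 ≤ L := by omega
  have hLr : (2 : ℝ) ≤ L := by exact_mod_cast hL
  have hdr : (0 : ℝ) ≤ d := Nat.cast_nonneg d
  have hC6 := two_le_C6' (d := d)
  have hs₁' : 10 * C6 d * α₄ ≤ 1 := by
    have h0 : 0 ≤ C6 d * α₄ := by positivity
    linarith
  have hα₃50 : α₃ ≤ 1 / 50 := hα₃'.trans (by norm_num)
  have hP10 := prop10_generalZ hLs hs1 hd hV h52 h176 h177 hu₁ hη hk hα₀ hα₃ hα₃50 hα₄ hs₁' hs₂ hs₃ hs₄ hs₅ hs₆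
  set K : ℝ := 4416 * ((d : ℝ) + 1) * C6 d * (α₃ * α₄ + α₄ ^ 2) with hK
  have hK0 : 0 ≤ K := by rw [hK]; positivity
  intro j
  induction j with
  | zero =>
    intro _ z
    simp
  | succ j ih =>
    intro hjk z
    have hjlt : j < k := Nat.lt_of_succ_le hjk
    have hIH := ih hjlt.le
    obtain ⟨hB, hS⟩ := hP10 j hjlt.le
    -- scale parameters `t = Lʲη`, `u = L^{j+1}η = Lt`
    obtain ⟨ht1, -⟩ := pow_eta_le hL1 hη hk hjlt.le
    obtain ⟨hu1, -⟩ := pow_eta_le hL1 hη hk (Nat.succ_le_of_lt hjlt)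
    set t : ℝ := (L : ℝ) ^ j * η with ht
    set u : ℝ := (L : ℝ) ^ (j + 1) * η with hu
    have ht0 : 0 ≤ t := by positivity
    have hu' : u = (L : ℝ) * t := by rw [hu, ht, pow_succ]; ring
    have hu0 : 0 ≤ u := by positivity
    have ht2 : t ^ 2 ≤ t := by rw [sq]; exact mul_le_of_le_one_left ht0 ht1
    -- level constants: (204) ≤ C₆α₄, (203) ≤ 2α₄t
    have h204 : rhs204G d L j α₀ α₄ η ≤ C6 d * α₄ := rhs204G_le hL hα₀ hα₄ hη ht1 hs₆
    have h203 : rhs203G d L j α₀ α₃ α₄ η ≤ 2 * α₄ * t := rhs203G_le hα₄ hη ht1 hs₃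
    -- the data of the one step at level `j`: background `Ū₀ʲ`, `v′ = ũ′ʲ`, `v₁ = ū₁ʲ`
    have hVj : ∀ (x : SiteZ d) (κ : Fin d), avgIterZ L U₀ j x κ ∈ U1 𝔸 := hV j hjlt
    have h44 : ∀ (x : SiteZ d) (κ μ : Fin d), κ ≠ μ →
        ‖((hol (avgIterZ L U₀ j) x (plaqWord κ μ) : 𝔸ˣ) : 𝔸) - 1‖ ≤ 2 * α₀ * t ^ 2 :=
      fun x κ μ hκμ => h52 j hjlt x κ μ hκμ
    have h4a : SiteBd (utilGZ L U₀ u' u₁ j) (C6 d * α₄) := siteBd_mono hS h204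
    have h4b : CovBondBd (avgIterZ L U₀ j) (utilGZ L U₀ u' u₁ j) (2 * α₄ * t) := covBondBd_mono hB h203
    have h3c : SiteBd (uavgZ L U₀ u₁ j) α₃ := fun x => hu₁.1 j hjlt.le x
    have h3d : CovBlockBdZ L (avgIterZ L U₀ j) (uavgZ L U₀ u₁ j) (α₃ * u) := by
      intro z' r
      have h := hu₁.2 j hjlt z' r
      rw [R0fun_add]
      calc _ ≤ α₃ * (L : ℝ) ^ (j + 1) * η := h
        _ = α₃ * u := by rw [hu]; ring
    -- smallness of the one step
    have hα₄j : C6 d * α₄ ≤ 1 / 50 := by linarith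
    have hβ : 200 * (α₃ * u) ≤ 1 := by
      have h1 : α₃ * u ≤ α₃ := mul_le_of_le_one_right hα₃ hu1
      linarith
    have hα₀j : 0 ≤ 2 * α₀ * t ^ 2 := by positivity
    have ha' : 2 * α₄ * t + 4 * (d * L * (2 * α₀ * t ^ 2)) * (C6 d * α₄) ≤ 3 * α₄ * t := by
      have e : 4 * (d * L * (2 * α₀ * t ^ 2)) * (C6 d * α₄) = (8 * d * C6 d * L * α₀) * (α₄ * t ^ 2) := by ring
      have h1 : (8 * d * C6 d * L * α₀) * (α₄ * t ^ 2) ≤ 1 * (α₄ * t ^ 2) :=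
        mul_le_mul_of_nonneg_right hs₇ (by positivity)
      have h2 : α₄ * t ^ 2 ≤ α₄ * t := mul_le_mul_of_nonneg_left ht2 hα₄
      rw [e]; linarith
    have ha'0 : 0 ≤ 2 * α₄ * t + 4 * (d * L * (2 * α₀ * t ^ 2)) * (C6 d * α₄) := by positivity
    have hs : 1000 * ((d : ℝ) + 1) * L * (2 * α₄ * t + 4 * (d * L * (2 * α₀ * t ^ 2)) * (C6 d * α₄)) ≤ 1 := by
      have h0 : 0 ≤ 1000 * ((d : ℝ) + 1) * L := by positivity
      have h1 := mul_le_mul_of_nonneg_left ha' h0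
      have h2 : 1000 * ((d : ℝ) + 1) * L * (3 * α₄ * t) = (3000 * ((d : ℝ) + 1) * L * α₄) * t := by ring
      have h3 : (3000 * ((d : ℝ) + 1) * L * α₄) * t ≤ 1 * 1 := mul_le_mul hs₂ ht1 ht0 (by norm_num)
      linarith
    -- the one step (211) at level `j`
    have hstep := eq211Z_general hLs hVj hα₀j h44 h4a h4b h3c h3d hα₄j (by positivity) (hα₃'.trans (by norm_num)) hβ hs z
    -- its error is `≤ K·u`
    have herr : 448 * ((d : ℝ) + 1) * L * (C6 d * α₄) * (2 * α₄ * t + 4 * (d * L * (2 * α₀ * t ^ 2)) * (C6 d * α₄)) +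
        368 * ((d : ℝ) + 1) * L * (2 * α₄ * t + 4 * (d * L * (2 * α₀ * t ^ 2)) * (C6 d * α₄)) * (4 * (α₃ * u)) ≤ K * u := by
      have c1 : 0 ≤ 448 * ((d : ℝ) + 1) * L * (C6 d * α₄) := by positivity
      have c2 : 0 ≤ 368 * ((d : ℝ) + 1) * L := by positivity
      have c3 : 0 ≤ 4 * (α₃ * u) := by positivity
      have e1 : 448 * ((d : ℝ) + 1) * L * (C6 d * α₄) * (2 * α₄ * t + 4 * (d * L * (2 * α₀ * t ^ 2)) * (C6 d * α₄)) ≤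
          448 * ((d : ℝ) + 1) * L * (C6 d * α₄) * (3 * α₄ * t) := mul_le_mul_of_nonneg_left ha' c1
      have e2 : 368 * ((d : ℝ) + 1) * L * (2 * α₄ * t + 4 * (d * L * (2 * α₀ * t ^ 2)) * (C6 d * α₄)) * (4 * (α₃ * u)) ≤
          368 * ((d : ℝ) + 1) * L * (3 * α₄ * t) * (4 * (α₃ * u)) :=
        mul_le_mul_of_nonneg_right (mul_le_mul_of_nonneg_left ha' c2) c3
      have e3 : 448 * ((d : ℝ) + 1) * L * (C6 d * α₄) * (3 * α₄ * t) = 1344 * ((d : ℝ) + 1) * C6 d * α₄ ^ 2 * u := by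
        rw [hu']; ring
      have e4 : 368 * ((d : ℝ) + 1) * L * (3 * α₄ * t) * (4 * (α₃ * u)) = 4416 * ((d : ℝ) + 1) * (α₃ * α₄) * (u * u) := by
        rw [hu']; ring
      have e5 : u * u ≤ u := mul_le_of_le_one_left hu0 hu1
      have e6 : 4416 * ((d : ℝ) + 1) * (α₃ * α₄) * (u * u) ≤ 4416 * ((d : ℝ) + 1) * (α₃ * α₄) * u :=
        mul_le_mul_of_nonneg_left e5 (by positivity)
      have e7 : 4416 * ((d : ℝ) + 1) * (α₃ * α₄) * u ≤ 4416 * ((d : ℝ) + 1) * C6 d * (α₃ * α₄) * u := by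
        have h0 : 0 ≤ 4416 * ((d : ℝ) + 1) * (α₃ * α₄) * u := by positivity
        have h1 : 4416 * ((d : ℝ) + 1) * (α₃ * α₄) * u * 1 ≤ 4416 * ((d : ℝ) + 1) * (α₃ * α₄) * u * C6 d :=
          mul_le_mul_of_nonneg_left (by linarith) h0
        have h2 : 4416 * ((d : ℝ) + 1) * (α₃ * α₄) * u * C6 d = 4416 * ((d : ℝ) + 1) * C6 d * (α₃ * α₄) * u := by ring
        linarith
      have e8 : 1344 * ((d : ℝ) + 1) * C6 d * α₄ ^ 2 * u ≤ 4416 * ((d : ℝ) + 1) * C6 d * α₄ ^ 2 * u := by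
        have h0 : 0 ≤ ((d : ℝ) + 1) * C6 d * α₄ ^ 2 * u := by positivity
        linarith
      have e9 : 4416 * ((d : ℝ) + 1) * C6 d * α₄ ^ 2 * u + 4416 * ((d : ℝ) + 1) * C6 d * (α₃ * α₄) * u = K * u := by
        rw [hK]; ring
      linarith
    -- assemble: `D_{j+1}(z) = [one step] + Q′(D_j)`
    have eU : utilGZ L U₀ u' u₁ (j + 1) z =
        vtilGZ L (avgIterZ L U₀ j) (utilGZ L U₀ u' u₁ j) (uavgZ L U₀ u₁ j) ((L : ℤ) • z) := by
      rw [utilGZ_succ]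
    rw [eU, lamAvgGZ_succ]
    have hDj : ‖rlamZ L (avgIterZ L U₀ j) (fun x => mlog ((utilGZ L U₀ u' u₁ j x : 𝔸ˣ) : 𝔸)) ((L : ℤ) • z) -
        rlamZ L (avgIterZ L U₀ j) (lamAvgGZ L U₀ j (fun x => mlog ((u' x : 𝔸ˣ) : 𝔸))) ((L : ℤ) • z)‖
          ≤ K * ∑ i ∈ range j, (L : ℝ) ^ (i + 1) * η := by
      rw [rlamZ_sub]
      exact norm_rlamZ_le hL1 hVj (fun x => hIH x) _
    calc _ ≤ ‖mlog ((vtilGZ L (avgIterZ L U₀ j) (utilGZ L U₀ u' u₁ j) (uavgZ L U₀ u₁ j) ((L : ℤ) • z) : 𝔸ˣ) : 𝔸) -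
            rlamZ L (avgIterZ L U₀ j) (fun x => mlog ((utilGZ L U₀ u' u₁ j x : 𝔸ˣ) : 𝔸)) ((L : ℤ) • z)‖ +
          ‖rlamZ L (avgIterZ L U₀ j) (fun x => mlog ((utilGZ L U₀ u' u₁ j x : 𝔸ˣ) : 𝔸)) ((L : ℤ) • z) -
            rlamZ L (avgIterZ L U₀ j) (lamAvgGZ L U₀ j (fun x => mlog ((u' x : 𝔸ˣ) : 𝔸))) ((L : ℤ) • z)‖ :=
          norm_sub_le_norm_sub_add_norm_sub _ _ _
      _ ≤ K * u + K * ∑ i ∈ range j, (L : ℝ) ^ (i + 1) * η := add_le_add (hstep.trans herr) hDj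
      _ = K * ∑ i ∈ range (j + 1), (L : ℝ) ^ (i + 1) * η := by rw [sum_range_succ, hu]; ring

/-- **(213)–(214) AT A GENERAL BACKGROUND, kernel form.**  Print (p. 50): "`Q′_j(u₁, λ, y) = (Q′_jλ)(y) + C′_j(u₁, λ, y)`, (213)
`|C′_j(u₁, λ, y)| = O((α₃α₄ + α₄²)Lʲη)`. (214)" — under the hypotheses of `eq212_general` (= those of
`B7Prop10General.prop10_general` plus `α₃ ≤ 1/200`, `50C₆α₄ ≤ 1`, `8dC₆Lα₀ ≤ 1`): for all `j ≤ k` and all `y`, the remainder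
`C′_j(u₁, λ, y) := log ũ′ʲ(y) − (Q′_jλ)(y)` satisfies `‖C′_j(u₁, λ, y)‖ ≤ C′_gen·(α₃α₄ + α₄²)·Lʲη` with the explicit `C′_gen = Cgen d =
8832(d+1)C₆` (depending on `d` only — print's shape `O((α₃α₄ + α₄²)Lʲη)` exactly) — from `eq212_general` and `Σ_{l<j} L^{l+1}η ≤ 2Lʲη`
(`L ≥ 2`, `B7.sum_pow_succ_le`; the level bookkeeping (212) ⇒ (214) in print's letters is `B7Eq214.ineq214_of_212`).  The abstract-carrier
citation statement is `B7Eq214.Eq214Printed`; at `U₀ = 1` this is `B7Eq214Flat.eq214_flat` up to the constants (`utilG_one_left`,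
`lamAvgG_one_left`, `avgIter_one`). [cite: Balaban1985Averaging, (213)–(214) p.50] -/
theorem eq214Z_general (hLs : L = 2 * s + 1) (hs1 : 1 ≤ s) (hd : 1 ≤ d)
    (hV : ∀ j < k, ∀ (x : SiteZ d) (κ : Fin d), avgIterZ L U₀ j x κ ∈ U1 𝔸)
    (h52 : ∀ j < k, ∀ (x : SiteZ d) (κ μ : Fin d), κ ≠ μ →
      ‖((hol (avgIterZ L U₀ j) x (plaqWord κ μ) : 𝔸ˣ) : 𝔸) - 1‖ ≤ 2 * α₀ * ((L : ℝ) ^ j * η) ^ 2)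
    (h176 : SiteBd u' α₄) (h177 : CovBondBd U₀ u' (α₄ * η)) (hu₁ : InLambdaZ L U₀ u₁ k α₃ η)
    (hη : 0 ≤ η) (hk : (L : ℝ) ^ k * η ≤ 1) (hα₀ : 0 ≤ α₀) (hα₃ : 0 ≤ α₃) (hα₃' : α₃ ≤ 1 / 200) (hα₄ : 0 ≤ α₄)
    (hs₁ : 50 * C6 d * α₄ ≤ 1) (hs₂ : 3000 * ((d : ℝ) + 1) * L * α₄ ≤ 1) (hs₃ : C4G d L * (α₀ + α₃ + α₄) ≤ 1)
    (hs₄ : 1024 * ((d : ℝ) + 1) * ((d : ℝ) + 4) * L ^ 2 * α₀ ≤ 1) (hs₅ : 32 * ((d : ℝ) + 1) ^ 2 * C6 d * L ^ 2 * α₀ ≤ 1)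
    (hs₆ : 16 * d * C5' d * C6 d * (L : ℝ) ^ 2 * α₀ ≤ 1) (hs₇ : 8 * d * C6 d * L * α₀ ≤ 1) :
    ∀ j ≤ k, ∀ z : SiteZ d,
      ‖mlog ((utilGZ L U₀ u' u₁ j z : 𝔸ˣ) : 𝔸) - lamAvgGZ L U₀ j (fun x => mlog ((u' x : 𝔸ˣ) : 𝔸)) z‖
        ≤ Cgen d * (α₃ * α₄ + α₄ ^ 2) * ((L : ℝ) ^ j * η) := by
  intro j hj z
  have hLr : (2 : ℝ) ≤ L := by exact_mod_cast (show 2 ≤ L by omega)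
  have h := eq212Z_general hLs hs1 hd hV h52 h176 h177 hu₁ hη hk hα₀ hα₃ hα₃' hα₄ hs₁ hs₂ hs₃ hs₄ hs₅ hs₆ hs₇ j hj z
  have hs := B7.sum_pow_succ_le (L : ℝ) η hLr hη j
  have h0 : 0 ≤ 4416 * ((d : ℝ) + 1) * C6 d * (α₃ * α₄ + α₄ ^ 2) := by
    have := two_le_C6' (d := d); positivity
  calc _ ≤ _ := h
    _ ≤ 4416 * ((d : ℝ) + 1) * C6 d * (α₃ * α₄ + α₄ ^ 2) * (2 * ((L : ℝ) ^ j * η)) :=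
        mul_le_mul_of_nonneg_left hs h0
    _ = Cgen d * (α₃ * α₄ + α₄ ^ 2) * ((L : ℝ) ^ j * η) := by rw [Cgen]; ring

/-- **(213)–(214) AT A GENERAL BACKGROUND UNDER (52)** — `eq214_general` with its level hypotheses DISCHARGED by Proposition 2
(`B7Prop10General.levels_of52`: p. 49 "`α₀` replaced by `2α₀(Lʲη)²`", `η = L^{−k}`): for `U₀` with values in an average-closed
subgroup `G ⊂ U1` (`B7Prop2Explicit.AvgClosed`, e.g. `unitaryUnits 𝔸`) satisfying (52) `sup_p‖U₀(∂p) − 1‖ < α₀η²`, and `u′, u₁` with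
(176), (177), (166)–(167): `‖log ũ′ʲ(y) − (Q′_jλ)(y)‖ ≤ C′_gen(α₃α₄ + α₄²)Lʲη` for all `j ≤ k`, `y`.  Smallness: that of
`eq214_general` plus Prop. 2's `C₀α₀ ≤ ⅓`, `2α₀ ≤ c′₂`. [cite: Balaban1985Averaging, (213)–(214) p.50, Proposition 2 p.26, Proposition 10 p.50] -/
theorem eq214Z_general_of52 (hLs : L = 2 * s + 1) (hs1 : 1 ≤ s) (hd : 1 ≤ d) {G : Subgroup 𝔸ˣ} (hG : AvgClosedZ d L G) (hU : ∀ x κ, U₀ x κ ∈ G)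
    (hα : 0 < α₀) (hα3 : C0Z d * α₀ ≤ 1 / 3) (hα4 : 4 * α₀ ≤ c2' d L)
    (h52 : pdev U₀ < α₀ * (((L : ℝ) ^ k)⁻¹) ^ 2)
    (h176 : SiteBd u' α₄) (h177 : CovBondBd U₀ u' (α₄ * ((L : ℝ) ^ k)⁻¹))
    (hu₁ : InLambdaZ L U₀ u₁ k α₃ (((L : ℝ) ^ k)⁻¹))
    (hα₃ : 0 ≤ α₃) (hα₃' : α₃ ≤ 1 / 200) (hα₄ : 0 ≤ α₄)
    (hs₁ : 50 * C6 d * α₄ ≤ 1) (hs₂ : 3000 * ((d : ℝ) + 1) * L * α₄ ≤ 1) (hs₃ : C4G d L * (α₀ + α₃ + α₄) ≤ 1)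
    (hs₄ : 1024 * ((d : ℝ) + 1) * ((d : ℝ) + 4) * L ^ 2 * α₀ ≤ 1) (hs₅ : 32 * ((d : ℝ) + 1) ^ 2 * C6 d * L ^ 2 * α₀ ≤ 1)
    (hs₆ : 16 * d * C5' d * C6 d * (L : ℝ) ^ 2 * α₀ ≤ 1) (hs₇ : 8 * d * C6 d * L * α₀ ≤ 1) :
    ∀ j ≤ k, ∀ z : SiteZ d,
      ‖mlog ((utilGZ L U₀ u' u₁ j z : 𝔸ˣ) : 𝔸) - lamAvgGZ L U₀ j (fun x => mlog ((u' x : 𝔸ˣ) : 𝔸)) z‖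
        ≤ Cgen d * (α₃ * α₄ + α₄ ^ 2) * ((L : ℝ) ^ j * ((L : ℝ) ^ k)⁻¹) := by
  have hL : 2 ≤ L := by omega
  obtain ⟨hV, hP⟩ := levels_of52Z hL hG hU k hα hα3 hα4 h52
  have hη : (0 : ℝ) ≤ ((L : ℝ) ^ k)⁻¹ := by positivity
  have hk : (L : ℝ) ^ k * ((L : ℝ) ^ k)⁻¹ ≤ 1 := by rw [mul_inv_cancel₀ (by positivity)]
  exact eq214Z_general hLs hs1 hd (fun j hj => hV j hj.le) (fun j hj => hP j hj.le) h176 h177 hu₁ hη hk hα.le hα₃ hα₃' hα₄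
    hs₁ hs₂ hs₃ hs₄ hs₅ hs₆ hs₇

/-- **(207) ⇒ (213)–(214) AT A GENERAL BACKGROUND, in print's datum `λ`.**  Print (p. 50): "The assumptions (176), (177) can
be reformulated in terms of the functions `λ = (1/i) log u′`. If we assume `|(D^η_{U₀}λ)(b)| < α₄, |λ(x)| < α₄, λ(x) ∈ 𝔤ᶜ, α₄`
sufficiently small, (207) then assumptions (176), (177) are satisfied with a constant `4α₄` instead of `α₄`. … hence
`Q′_j(u₁, λ, y) = (Q′_jλ)(y) + C′_j(u₁, λ, y)`, (213) `|C′_j(u₁, λ, y)| = O((α₃α₄ + α₄²)Lʲη)`. (214)"  HERE: `U₀` with values in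
an average-closed subgroup `G ⊂ U1` satisfying (52) `sup_p‖U₀(∂p) − 1‖ < α₀η²`, `η = L^{−k}`; the datum `λ : ℤᵈ → 𝔸` with (207)
`‖R(U_{0,b})λ(b₊) − λ(b₋)‖ < α₄η` (`= η|(D^η_{U₀}λ)(b)|`, the covariant `η`-lattice derivative, (56) `R(X)Y = XYX⁻¹`) and
`‖λ(x)‖ < α₄`; `u′ := e^{λ}`; `u₁ ∈ Λ_k(U₀, α₃)` ((166)–(167)); smallness = that of `eq214_general_of52` at `α₄ ↦ 4α₄`
(`200C₆α₄ ≤ 1`, `12·10³(d+1)Lα₄ ≤ 1`, `C₄(α₀ + α₃ + 4α₄) ≤ 1`, the `α₀`-conditions unchanged).  THEN for all `j ≤ k`, `z`: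
`‖log ũ′ʲ(z) − (Q′_jλ)(z)‖ ≤ 16C′_gen·(α₃α₄ + α₄²)·Lʲη` — (213) with `C′_j(u₁, λ, ·) := log ũ′ʲ − Q′_jλ` and (214) explicit.
PROOF = print's: (207) ⇒ (176)/(177) with `4α₄` is `B7Eq214.ineq176_of_207` / `ineq177_of_207` (the latter for the bond
expression `e^{−λ(b₋)}R(U_{0,b})e^{λ(b₊)}` of `CovBondBd`), then `eq214_general_of52` at `α₄ ↦ 4α₄` and `log e^{λ(x)} = λ(x)`
(`B7Eq170Flat.mlog_exp_of_le`).  At `U₀ = 1`: `B7Eq214FlatQprime.eq214_flat_of_207` (p22) up to the constants.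
[cite: Balaban1985Averaging, (207) + (213)–(214) p.50] -/
theorem eq214Z_general_of207 (hLs : L = 2 * s + 1) (hs1 : 1 ≤ s) (hd : 1 ≤ d) {G : Subgroup 𝔸ˣ} (hG : AvgClosedZ d L G) (hU : ∀ x κ, U₀ x κ ∈ G)
    (hα : 0 < α₀) (hα3 : C0Z d * α₀ ≤ 1 / 3) (hα4 : 4 * α₀ ≤ c2' d L)
    (h52 : pdev U₀ < α₀ * (((L : ℝ) ^ k)⁻¹) ^ 2)
    {lam : SiteZ d → 𝔸}
    (h207a : ∀ (x : SiteZ d) (κ : Fin d), ‖cj (U₀ x κ) (lam (x + e κ)) - lam x‖ < α₄ * ((L : ℝ) ^ k)⁻¹)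
    (h207b : ∀ x : SiteZ d, ‖lam x‖ < α₄)
    (hu₁ : InLambdaZ L U₀ u₁ k α₃ (((L : ℝ) ^ k)⁻¹))
    (hα₃ : 0 ≤ α₃) (hα₃' : α₃ ≤ 1 / 200)
    (hs₁ : 200 * C6 d * α₄ ≤ 1) (hs₂ : 12000 * ((d : ℝ) + 1) * L * α₄ ≤ 1) (hs₃ : C4G d L * (α₀ + α₃ + 4 * α₄) ≤ 1)
    (hs₄ : 1024 * ((d : ℝ) + 1) * ((d : ℝ) + 4) * L ^ 2 * α₀ ≤ 1) (hs₅ : 32 * ((d : ℝ) + 1) ^ 2 * C6 d * L ^ 2 * α₀ ≤ 1)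
    (hs₆ : 16 * d * C5' d * C6 d * (L : ℝ) ^ 2 * α₀ ≤ 1) (hs₇ : 8 * d * C6 d * L * α₀ ≤ 1) :
    ∀ j ≤ k, ∀ z : SiteZ d,
      ‖mlog ((utilGZ L U₀ (fun x => expUnit (lam x)) u₁ j z : 𝔸ˣ) : 𝔸) - lamAvgGZ L U₀ j lam z‖
        ≤ 16 * Cgen d * (α₃ * α₄ + α₄ ^ 2) * ((L : ℝ) ^ j * ((L : ℝ) ^ k)⁻¹) := by
  have hL1 : 1 ≤ L := by omega
  have hLr : (1 : ℝ) ≤ L := by exact_mod_cast hL1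
  have hC6 := two_le_C6' (d := d)
  have hα₄0 : 0 ≤ α₄ := le_of_lt (lt_of_le_of_lt (norm_nonneg _) (h207b 0))
  have hα₄s : α₄ ≤ 1 / 400 := by
    have h1 : 2 * α₄ ≤ C6 d * α₄ := mul_le_mul_of_nonneg_right hC6 hα₄0
    linarith
  have hα₄' : α₄ ≤ 1 / 4 := hα₄s.trans (by norm_num)
  have hη1 : ((L : ℝ) ^ k)⁻¹ ≤ 1 := inv_le_one_of_one_le₀ (one_le_pow₀ hLr)
  -- (207) ⇒ (176), (177) with the constant `4α₄`
  have h176 : SiteBd (fun x => expUnit (lam x)) (4 * α₄) := fun x => by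
    show ‖((expUnit (lam x) : 𝔸ˣ) : 𝔸) - 1‖ ≤ 4 * α₄
    rw [val_expUnit]
    exact (B7Eq214.ineq176_of_207 (lam x) hα₄' (h207b x)).le
  have h177 : CovBondBd U₀ (fun x => expUnit (lam x)) (4 * α₄ * ((L : ℝ) ^ k)⁻¹) := fun x κ => by
    show ‖((((expUnit (lam x))⁻¹ * Rc (U₀ x κ) (expUnit (lam (x + e κ))) : 𝔸ˣ)) : 𝔸) - 1‖ ≤ 4 * α₄ * ((L : ℝ) ^ k)⁻¹
    rw [Units.val_mul, val_inv_expUnit, val_Rc_eq_cj, val_expUnit, cj_apply]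
    exact (B7Eq214.ineq177_of_207 (U₀ x κ) (lam x) (lam (x + e κ)) hα₄' hη1 (h207b x) (h207a x κ)).le
  -- `log e^{λ} = λ`
  have hlog : (fun x => mlog ((((fun x => expUnit (lam x)) x : 𝔸ˣ)) : 𝔸)) = lam :=
    funext fun x => by rw [val_expUnit, mlog_exp_of_le ((h207b x).le.trans (hα₄s.trans (by norm_num)))]
  have hs₁' : 50 * C6 d * (4 * α₄) ≤ 1 := by linarith
  have hs₂' : 3000 * ((d : ℝ) + 1) * L * (4 * α₄) ≤ 1 := by linarith
  have h := eq214Z_general_of52 hLs hs1 hd hG hU hα hα3 hα4 h52 h176 h177 hu₁ hα₃ hα₃' (by positivity) hs₁' hs₂' hs₃ hs₄ hs₅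
    hs₆ hs₇
  intro j hj z
  have hjz := h j hj z
  rw [hlog] at hjz
  refine hjz.trans ?_
  have hCg : 0 ≤ Cgen d := by unfold Cgen; positivity
  have ht : 0 ≤ (L : ℝ) ^ j * ((L : ℝ) ^ k)⁻¹ := by positivity
  have hβ : α₃ * (4 * α₄) + (4 * α₄) ^ 2 ≤ 16 * (α₃ * α₄ + α₄ ^ 2) := by nlinarith [mul_nonneg hα₃ hα₄0]
  calc Cgen d * (α₃ * (4 * α₄) + (4 * α₄) ^ 2) * ((L : ℝ) ^ j * ((L : ℝ) ^ k)⁻¹)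
      ≤ Cgen d * (16 * (α₃ * α₄ + α₄ ^ 2)) * ((L : ℝ) ^ j * ((L : ℝ) ^ k)⁻¹) := by gcongr
    _ = 16 * Cgen d * (α₃ * α₄ + α₄ ^ 2) * ((L : ℝ) ^ j * ((L : ℝ) ^ k)⁻¹) := by ring

end Levels

end Literature.MathematicalPhysics.QuantumFieldTheory.Balaban1983to89.B7Eq214GeneralRec
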